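import Summits.Ventures.HSemireg.OrlovIsometryGroupCM
import HarnessLib

/-!
# Orlov's group `U(E × Ê)` for a CM elliptic curve: the decomposition `g = λ · h` is unique up to sign

Venture cell `pub-hsemireg` (Lean root `Summits/Ventures/HSemireg/`), literature seat
`lit-w-polishchuk-orlov` (g7, 2026-08-23). Companion of `OrlovIsometryGroupCM.lean` (MAIN:
`g · adj(σ g) = 1 ⟺ g = λ · h`, `λ σ(λ) = 1`, `h ∈ SL(2, ℤ)`, i.e. `U = μ · SL₂(ℤ)`) and
`OrlovIsometryGroupCMQuadratic.lean` (imaginary-quadratic orders; `E_ω`: `μ₆`, `E_i`: `μ₄`). This file adds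
the UNIQUENESS half: `λ · h = λ' · h'` with `λ'` a unit and `h, h' ∈ SL(2, ℤ)` forces
`(λ, h) = ±(λ', h')`, so `(λ, h) ↦ λ · h` is exactly two-to-one `μ × SL(2, ℤ) ↠ U(E × Ê)` and, as sets,
`U ≅ (μ × SL(2, ℤ)) / ⟨(−1, −1)⟩`. This is the integral counterpart of the one PRINTED sentence on this group
for a CM elliptic curve, the real-points form "`U(ℝ) ≃ SL(2, ℝ) × U(1) / {±1}`"
[Polishchuk2014LIObjects, Examples 2.5.8 (3)] (held text `paper:arxiv-1203.2300` p0015:L41–47), and the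
structural reason for the factor `|μ_K| / 2` between the exact box counts of `U(E_K × Ê_K)` and of
`SL(2, ℤ)` in the cell's machine leg (Q1)(β) (`widen/LIT-W/tools/q1_unitary_enum.py`, box `B = 6`:
`744 = 2 · 372` for `ℤ[i]`, `1116 = 3 · 372` for `ℤ[ω]`; box `B = 4`: `360 = 2 · 180`, `540 = 3 · 180`):
by MAIN + this file, `U ∩ box` is the disjoint union of the `|μ_K| / 2` sets `±ζ · (SL(2, ℤ) ∩ box)`.

HONEST FRAMING: elementary statements about `2 × 2` matrices over a commutative ring of characteristic `0`;
DERIVED HERE, not printed statements (locator sheet `widen/LIT-W/LITW-POLISHCHUK-ORLOV-LOCATOR-SHEET.md`,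
(Q1), rule R3: never a quotation); nothing here constructs a derived category or an abelian variety, and
nothing here says that HC, HC_CM or HC_AV holds.

## Results (PROVED: no named fact, no `sorry`; imports the companion file + HarnessLib only)

* `orlovIsometric_smul_intCast_unique`: `λ · h = λ' · h'`, `h, h' ∈ SL(2, ℤ)`, `λ'` a unit ⟹
  `(λ = λ' ∧ h = h') ∨ (λ = −λ' ∧ h = −h')`. Proof: `P := h · adj(h')` is an integer matrix with
  `λ · P = λ' · 1` entrywise, so `λ` is a unit, `P` is diagonal with equal diagonal entries, and
  `det P = det h · det h' = 1` forces `P = ±1`; written out on the eight integer entries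
  (`linear_combination`).
* `orlovIsometric_decomposition_unique`: the same with the hypothesis `λ' σ(λ') = 1` of MAIN.
-/

namespace Summit.Ventures.HSemireg

open Matrix
open scoped MatrixGroups

variable {R : Type*} [CommRing R]

/-- **The decomposition `g = λ · h` is unique up to `(λ, h) ↦ (−λ, −h)`.** In a commutative ring of
characteristic `0`: if `λ · h = λ' · h'` with `h, h' ∈ SL(2, ℤ)` (cast entrywise) and `λ'` a unit, then
`(λ, h) = (λ', h')` or `(λ, h) = (−λ', −h')`. With `orlovIsometric_iff_exists_smul_specialLinearGroup`:
`(λ, h) ↦ λ · h` maps `μ × SL(2, ℤ)` onto `U(E × Ê)` with fibres `{(λ, h), (−λ, −h)}` — the integral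
counterpart of the printed real-points form `U(ℝ) ≃ SL(2, ℝ) × U(1) / {±1}` for a CM elliptic curve
[cite: Polishchuk2014LIObjects, Ex 2.5.8 (3)]. DERIVED HERE (elementary linear algebra); not a printed
statement. -/
theorem orlovIsometric_smul_intCast_unique [CharZero R] {l l' : R} (hl' : IsUnit l')
    {k k' : SL(2, ℤ)}
    (h : l • (k : Matrix (Fin 2) (Fin 2) ℤ).map (Int.castRingHom R) =
      l' • (k' : Matrix (Fin 2) (Fin 2) ℤ).map (Int.castRingHom R)) :
    (l = l' ∧ k = k') ∨ (l = -l' ∧ k = -k') := by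
  -- entry equations `l · k i j = l' · k' i j` in `R`
  have hent : ∀ i j, l * ((k : Matrix (Fin 2) (Fin 2) ℤ) i j : R) =
      l' * ((k' : Matrix (Fin 2) (Fin 2) ℤ) i j : R) := by
    intro i j
    have := congrFun (congrFun h i) j
    simpa [Matrix.smul_apply, Matrix.map_apply] using this
  have h00 := hent 0 0
  have h01 := hent 0 1
  have h10 := hent 1 0
  have h11 := hent 1 1
  -- the two determinant conditions, in `ℤ` and cast to `R`
  have hda : (k : Matrix (Fin 2) (Fin 2) ℤ) 0 0 * (k : Matrix (Fin 2) (Fin 2) ℤ) 1 1 -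
      (k : Matrix (Fin 2) (Fin 2) ℤ) 0 1 * (k : Matrix (Fin 2) (Fin 2) ℤ) 1 0 = 1 := by
    rw [← Matrix.det_fin_two]; exact k.det_coe
  have hdb : (k' : Matrix (Fin 2) (Fin 2) ℤ) 0 0 * (k' : Matrix (Fin 2) (Fin 2) ℤ) 1 1 -
      (k' : Matrix (Fin 2) (Fin 2) ℤ) 0 1 * (k' : Matrix (Fin 2) (Fin 2) ℤ) 1 0 = 1 := by
    rw [← Matrix.det_fin_two]; exact k'.det_coe
  have hdbR : ((k' : Matrix (Fin 2) (Fin 2) ℤ) 0 0 : R) * ((k' : Matrix (Fin 2) (Fin 2) ℤ) 1 1 : R) -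
      ((k' : Matrix (Fin 2) (Fin 2) ℤ) 0 1 : R) * ((k' : Matrix (Fin 2) (Fin 2) ℤ) 1 0 : R) = 1 := by
    exact_mod_cast congrArg (Int.cast : ℤ → R) hdb
  -- abbreviations for the eight integer entries
  set a00 := (k : Matrix (Fin 2) (Fin 2) ℤ) 0 0
  set a01 := (k : Matrix (Fin 2) (Fin 2) ℤ) 0 1
  set a10 := (k : Matrix (Fin 2) (Fin 2) ℤ) 1 0
  set a11 := (k : Matrix (Fin 2) (Fin 2) ℤ) 1 1
  set b00 := (k' : Matrix (Fin 2) (Fin 2) ℤ) 0 0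
  set b01 := (k' : Matrix (Fin 2) (Fin 2) ℤ) 0 1
  set b10 := (k' : Matrix (Fin 2) (Fin 2) ℤ) 1 0
  set b11 := (k' : Matrix (Fin 2) (Fin 2) ℤ) 1 1
  -- `P := k · adj(k')`, an integer matrix with `det P = 1`; `l · P = l' · 1` entrywise
  have hP00 : l * ((a00 * b11 - a01 * b10 : ℤ) : R) = l' := by
    push_cast
    linear_combination (b11 : R) * h00 - (b10 : R) * h01 + l' * hdbR
  have hP11 : l * ((a11 * b00 - a10 * b01 : ℤ) : R) = l' := by
    push_cast
    linear_combination (b00 : R) * h11 - (b01 : R) * h10 + l' * hdbR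
  have hP01 : l * ((a01 * b00 - a00 * b01 : ℤ) : R) = 0 := by
    push_cast
    linear_combination (b00 : R) * h01 - (b01 : R) * h00
  have hP10 : l * ((a10 * b11 - a11 * b10 : ℤ) : R) = 0 := by
    push_cast
    linear_combination (b11 : R) * h10 - (b10 : R) * h11
  -- `l` is a unit (because `l · P₀₀ = l'` is), hence `P₀₁ = P₁₀ = 0` and `P₀₀ = P₁₁`
  have hl : IsUnit l := isUnit_of_mul_isUnit_left (hP00 ▸ hl')
  obtain ⟨u, hu⟩ := hl.exists_left_inv
  have cancel : ∀ m : ℤ, l * (m : R) = 0 → m = 0 := by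
    intro m hm
    have : (m : R) = 0 := by
      calc (m : R) = u * (l * (m : R)) := by rw [← mul_assoc, hu, one_mul]
        _ = 0 := by rw [hm, mul_zero]
    exact_mod_cast this
  have eP01 : a01 * b00 - a00 * b01 = 0 := cancel _ hP01
  have eP10 : a10 * b11 - a11 * b10 = 0 := cancel _ hP10
  have eP0011 : a00 * b11 - a01 * b10 = a11 * b00 - a10 * b01 := by
    have : l * (((a00 * b11 - a01 * b10 : ℤ) : R) - ((a11 * b00 - a10 * b01 : ℤ) : R)) = 0 := by
      rw [mul_sub, hP00, hP11, sub_self]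
    have h2 := cancel ((a00 * b11 - a01 * b10) - (a11 * b00 - a10 * b01)) (by push_cast at this ⊢; exact this)
    omega
  -- `det P = det k · det k' = 1` is the polynomial identity below; with `P₀₁ = 0` it gives `P₀₀² = 1`
  have hdetP : (a00 * b11 - a01 * b10) * (a11 * b00 - a10 * b01) -
      (a01 * b00 - a00 * b01) * (a10 * b11 - a11 * b10) = 1 := by
    linear_combination (b00 * b11 - b01 * b10) * hda + hdb
  have hsq : (a00 * b11 - a01 * b10) * (a00 * b11 - a01 * b10) = 1 := by
    have := hdetP
    rw [eP01, zero_mul, sub_zero, ← eP0011] at this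
    exact this
  -- so `e := P₀₀ = ±1`, `k = e · k'` entrywise and `l · e = l'`
  rcases Int.isUnit_iff.mp (IsUnit.of_mul_eq_one _ hsq) with he | he
  · -- `e = 1`: `(l, k) = (l', k')`
    have he' : a11 * b00 - a10 * b01 = 1 := by rw [← eP0011]; exact he
    left
    refine ⟨?_, Matrix.SpecialLinearGroup.ext _ _ ?_⟩
    · have := hP00
      rw [he] at this
      simpa using this
    · intro i j
      fin_cases i <;> fin_cases j
      · show a00 = b00
        linear_combination (-a00) * hdb + b00 * he + b10 * eP01
      · show a01 = b01
        linear_combination (-a01) * hdb + b01 * he + b11 * eP01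
      · show a10 = b10
        linear_combination (-a10) * hdb + b10 * he' + b00 * eP10
      · show a11 = b11
        linear_combination (-a11) * hdb + b11 * he' + b01 * eP10
  · -- `e = -1`: `(l, k) = (-l', -k')`
    have he' : a11 * b00 - a10 * b01 = -1 := by rw [← eP0011]; exact he
    right
    refine ⟨?_, Matrix.SpecialLinearGroup.ext _ _ ?_⟩
    · have := hP00
      rw [he] at this
      simp at this
      linear_combination (-1 : R) * this
    · intro i j
      rw [Matrix.SpecialLinearGroup.coe_neg, Matrix.neg_apply]
      fin_cases i <;> fin_cases j
      · show a00 = -b00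
        linear_combination (-a00) * hdb + b00 * he + b10 * eP01
      · show a01 = -b01
        linear_combination (-a01) * hdb + b01 * he + b11 * eP01
      · show a10 = -b10
        linear_combination (-a10) * hdb + b10 * he' + b00 * eP10
      · show a11 = -b11
        linear_combination (-a11) * hdb + b11 * he' + b01 * eP10

/-- **σ-form of the uniqueness.** Two decompositions `λ · h = λ' · h'` with `λ' σ(λ') = 1` (so `λ'` is a
unit) and `h, h' ∈ SL(2, ℤ)` agree up to the common sign: `(λ, h) = ±(λ', h')` — the uniqueness half of
`orlovIsometric_iff_exists_smul_specialLinearGroup` (`U = μ · SL₂(ℤ)`). DERIVED HERE; not a printed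
statement. -/
theorem orlovIsometric_decomposition_unique [CharZero R] (σ : R →+* R) {l l' : R} (hl' : l' * σ l' = 1)
    {k k' : SL(2, ℤ)}
    (h : l • (k : Matrix (Fin 2) (Fin 2) ℤ).map (Int.castRingHom R) =
      l' • (k' : Matrix (Fin 2) (Fin 2) ℤ).map (Int.castRingHom R)) :
    (l = l' ∧ k = k') ∨ (l = -l' ∧ k = -k') :=
  orlovIsometric_smul_intCast_unique (IsUnit.of_mul_eq_one _ hl') h

end Summit.Ventures.HSemireg
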